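import Literature.Barriers.ValiantsHypothesis.BIJL18MatrixCompletion

/-!
# Bläser–Ikenmeyer–Jindal–Lysikov 2018, Lemma 21 — PROVED (`BIJL2018_lemma21_holds`)

Discharge of the named fact `BIJL2018_lemma21` of `BIJL18MatrixCompletion.lean` (val-lit row
BIJL2018-A; M. Bläser, C. Ikenmeyer, G. Jindal, V. Lysikov, *Generalized matrix completion and
algebraic natural proofs*, STOC 2018 / ECCC TR18-064, Lemma 21): the `9 × 9` clause gadget
`gadget₉` of §5 has rank five for a Boolean assignment satisfying the clause (with suitable local
variables), and rank five forces the clause to be satisfied by a Boolean-valued variable,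
[cite: BlaserIkenmeyerJindalLysikov2018, Lemma 21].

The proof follows the print (ECCC p. 15–16):

* Part 1 (`rank_gadget₉_eq_five`): local variables `u = x, v = y, w = z` and `u₁ = s(u)`,
  `u₂ = u` (etc.) clear the off-block entries; the gadget becomes block diagonal with three
  blocks `[[1,x],[1,x]]` and the `3 × 3` clause block `[[1-ℓ(u),1,0],[0,1-ℓ(v),1],[0,0,1-ℓ(w)]]`
  of rank two. Rank `≤ 5` is certified by an explicit factorisation through `K⁵` (valid exactly
  when `(1-ℓ(u))(1-ℓ(v))(1-ℓ(w)) = 0`), rank `≥ 5` by a unit `5 × 5` minor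
  (`Literature.LinearAlgebra.Matrix.card_le_rank_of_det_submatrix_ne_zero`).
* Part 2 (`satisfiesLit_of_rank_gadget₉_eq_five`): the four printed `6 × 6` minors have
  determinants `u - x`, `v - y`, `w - z` and `(1-ℓ(u))(1-ℓ(v))(1-ℓ(w))`
  (`det_minor₁` … `det_minor₄`); rank five makes them vanish
  (`Literature.LinearAlgebra.Matrix.det_submatrix_eq_zero_of_rank_lt_card`), whence `x = u`,
  `y = v`, `z = w` and some literal equals one, i.e. the clause is satisfied by a `{0,1}`-valued
  variable. The minors are evaluated through the block-triangular shape "three unit rows, then a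
  `3 × 3` block" (`det_of_leading_rows`).

Theorem-only file (no definitions). Honest framing: a discharge of typed literature (net debt −1)
— a gadget computation inside an NP-hardness proof; VP ≠ VNP is NOT proved and nothing here is
progress on it.

## References
* [BlaserIkenmeyerJindalLysikov2018] M. Bläser, C. Ikenmeyer, G. Jindal, V. Lysikov, STOC 2018,
  doi:10.1145/3188745.3188832; ECCC TR18-064, §5, Lemma 21 and its proof (p. 14–16).
-/

noncomputable section

namespace Literature.Barriers.ValiantsHypothesis

open Matrix Literature.LinearAlgebra.Matrix

universe u

variable {K : Type u} [Field K]

namespace Lemma21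

/-! ### Block-triangular determinants: three unit rows, then a square block -/

/-- If the first three rows of a square matrix are the unit vectors `e₀, e₁, e₂`, its determinant
is that of the lower-right block (block lower-triangular shape with an identity corner).
[cite: BlaserIkenmeyerJindalLysikov2018, Lemma 21 (proof)] -/
theorem det_of_leading_rows {R : Type*} [CommRing R] {k : ℕ}
    (M : Matrix (Fin (3 + k)) (Fin (3 + k)) R)
    (h : ∀ (i : Fin 3) (j : Fin (3 + k)), M (Fin.castAdd k i) j = if (j : ℕ) = (i : ℕ) then 1 else 0) :
    M.det = (Matrix.of fun i j : Fin k => M (Fin.natAdd 3 i) (Fin.natAdd 3 j)).det := by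
  classical
  set e : Fin 3 ⊕ Fin k ≃ Fin (3 + k) := finSumFinEquiv with he
  rw [← Matrix.det_submatrix_equiv_self e M, ← Matrix.fromBlocks_toBlocks (M.submatrix e e)]
  have h11 : (M.submatrix e e).toBlocks₁₁ = 1 := by
    ext i j
    simp only [Matrix.toBlocks₁₁, Matrix.of_apply, Matrix.submatrix_apply, he,
      finSumFinEquiv_apply_left, h, Fin.val_castAdd, Matrix.one_apply, Fin.ext_iff]
    exact if_congr eq_comm rfl rfl
  have h12 : (M.submatrix e e).toBlocks₁₂ = 0 := by
    ext i j
    simp only [Matrix.toBlocks₁₂, Matrix.of_apply, Matrix.submatrix_apply, he,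
      finSumFinEquiv_apply_left, finSumFinEquiv_apply_right, h, Fin.val_natAdd, Matrix.zero_apply]
    rw [if_neg]
    have := i.isLt
    omega
  rw [h11, h12, Matrix.det_fromBlocks_zero₁₂, Matrix.det_one, one_mul]
  congr 1

/-! ### The four `6 × 6` minors of the proof of Lemma 21 (2) -/

/-- Minor 1 (rows `4,6,9` and columns `4,6,7` removed, printed numbering): determinant `u - x`.
[cite: BlaserIkenmeyerJindalLysikov2018, Lemma 21 (proof)] -/
theorem det_minor₁ (px py pz : Bool) (x y z u v w u₁ u₂ v₁ v₂ w₁ w₂ : K) :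
    ((gadget₉ K px py pz x y z u v w u₁ u₂ v₁ v₂ w₁ w₂).submatrix ![7, 2, 4, 0, 1, 6]
      ![8, 2, 4, 0, 1, 7]).det = u - x := by
  rw [← Matrix.det_transpose, Matrix.transpose_submatrix, det_of_leading_rows (k := 3)]
  · rw [Matrix.det_fin_three]
    simp [gadget₉, Matrix.submatrix_apply]
  · intro i j
    fin_cases i <;> fin_cases j <;> simp [gadget₉]

/-- Minor 2 (rows `2,6,9` and columns `2,6,7` removed): determinant `v - y`.
[cite: BlaserIkenmeyerJindalLysikov2018, Lemma 21 (proof)] -/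
theorem det_minor₂ (px py pz : Bool) (x y z u v w u₁ u₂ v₁ v₂ w₁ w₂ : K) :
    ((gadget₉ K px py pz x y z u v w u₁ u₂ v₁ v₂ w₁ w₂).submatrix ![0, 4, 6, 2, 3, 7]
      ![0, 4, 7, 2, 3, 8]).det = v - y := by
  rw [det_of_leading_rows (k := 3)]
  · rw [Matrix.det_fin_three]
    simp [gadget₉, Matrix.submatrix_apply]
  · intro i j
    fin_cases i <;> fin_cases j <;> simp [gadget₉]

/-- Minor 3 (rows `2,4,9` and columns `2,4,7` removed): determinant `w - z`.
[cite: BlaserIkenmeyerJindalLysikov2018, Lemma 21 (proof)] -/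
theorem det_minor₃ (px py pz : Bool) (x y z u v w u₁ u₂ v₁ v₂ w₁ w₂ : K) :
    ((gadget₉ K px py pz x y z u v w u₁ u₂ v₁ v₂ w₁ w₂).submatrix ![0, 2, 6, 4, 5, 7]
      ![0, 2, 7, 4, 5, 8]).det = w - z := by
  rw [det_of_leading_rows (k := 3)]
  · rw [Matrix.det_fin_three]
    simp [gadget₉, Matrix.submatrix_apply]
  · intro i j
    fin_cases i <;> fin_cases j <;> simp [gadget₉]

/-- Minor 4 (rows and columns `2,4,6` removed): determinant `(1-ℓ(u))(1-ℓ(v))(1-ℓ(w))`.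
[cite: BlaserIkenmeyerJindalLysikov2018, Lemma 21 (proof)] -/
theorem det_minor₄ (px py pz : Bool) (x y z u v w u₁ u₂ v₁ v₂ w₁ w₂ : K) :
    ((gadget₉ K px py pz x y z u v w u₁ u₂ v₁ v₂ w₁ w₂).submatrix ![0, 2, 4, 6, 7, 8]
      ![0, 2, 4, 6, 7, 8]).det = (1 - gl K px u) * (1 - gl K py v) * (1 - gl K pz w) := by
  rw [det_of_leading_rows (k := 3)]
  · rw [Matrix.det_fin_three]
    simp [gadget₉, Matrix.submatrix_apply]
  · intro i j
    fin_cases i <;> fin_cases j <;> simp [gadget₉]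

/-- A literal that evaluates to one is satisfied by a `{0,1}`-value: `1 - ℓ(a) = 0` gives
`SatisfiesLit`. [cite: BlaserIkenmeyerJindalLysikov2018, Lemma 21 (proof)] -/
theorem satisfiesLit_of_sub_gl_eq_zero (pos : Bool) (a : K) (h : 1 - gl K pos a = 0) :
    SatisfiesLit K pos a := by
  unfold SatisfiesLit
  cases pos with
  | true =>
    left
    simp only [gl, if_true] at h
    exact ⟨(sub_eq_zero.1 h).symm, rfl⟩
  | false =>
    right
    simp only [gl] at h
    refine ⟨?_, rfl⟩
    simpa using h

/-! ### Lemma 21 (2): rank five forces satisfaction -/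

/-- **Lemma 21, part 2.** If the clause gadget has rank five then `x = u`, `y = v`, `z = w` and
at least one literal is satisfied by a `{0,1}`-valued variable.
[cite: BlaserIkenmeyerJindalLysikov2018, Lemma 21 (2)] -/
theorem satisfiesLit_of_rank_gadget₉_eq_five (px py pz : Bool)
    (x y z u v w u₁ u₂ v₁ v₂ w₁ w₂ : K)
    (h : (gadget₉ K px py pz x y z u v w u₁ u₂ v₁ v₂ w₁ w₂).rank = 5) :
    SatisfiesLit K px x ∨ SatisfiesLit K py y ∨ SatisfiesLit K pz z := by
  classical
  have hlt : (gadget₉ K px py pz x y z u v w u₁ u₂ v₁ v₂ w₁ w₂).rank < Fintype.card (Fin 6) := by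
    rw [h, Fintype.card_fin]; norm_num
  have h1 := det_submatrix_eq_zero_of_rank_lt_card _ ![7, 2, 4, 0, 1, 6] ![8, 2, 4, 0, 1, 7] hlt
  have h2 := det_submatrix_eq_zero_of_rank_lt_card _ ![0, 4, 6, 2, 3, 7] ![0, 4, 7, 2, 3, 8] hlt
  have h3 := det_submatrix_eq_zero_of_rank_lt_card _ ![0, 2, 6, 4, 5, 7] ![0, 2, 7, 4, 5, 8] hlt
  have h4 := det_submatrix_eq_zero_of_rank_lt_card _ ![0, 2, 4, 6, 7, 8] ![0, 2, 4, 6, 7, 8] hlt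
  rw [det_minor₁, sub_eq_zero] at h1
  rw [det_minor₂, sub_eq_zero] at h2
  rw [det_minor₃, sub_eq_zero] at h3
  rw [det_minor₄, h1, h2, h3] at h4
  rcases mul_eq_zero.1 h4 with h12 | hc
  · rcases mul_eq_zero.1 h12 with ha | hb
    · exact Or.inl (satisfiesLit_of_sub_gl_eq_zero px x ha)
    · exact Or.inr (Or.inl (satisfiesLit_of_sub_gl_eq_zero py y hb))
  · exact Or.inr (Or.inr (satisfiesLit_of_sub_gl_eq_zero pz z hc))

/-! ### Lemma 21 (1): a satisfying Boolean assignment gives rank five -/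

/-- A satisfied literal kills its diagonal entry of the clause block: `1 - ℓ(a) = 0`.
[cite: BlaserIkenmeyerJindalLysikov2018, Lemma 21 (proof)] -/
theorem sub_gl_eq_zero_of_satisfiesLit (pos : Bool) (a : K) (h : SatisfiesLit K pos a) :
    1 - gl K pos a = 0 := by
  rcases h with ⟨rfl, rfl⟩ | ⟨rfl, rfl⟩ <;> simp [gl]

/-- **Lemma 21, part 1 (the witness).** With the local variables `u = x, v = y, w = z`,
`u₁ = s(u)`, `u₂ = u` (and likewise for `v, w`), the gadget has rank five as soon as one literal
is satisfied by a `{0,1}`-valued variable. [cite: BlaserIkenmeyerJindalLysikov2018, Lemma 21 (1)] -/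
theorem rank_gadget₉_eq_five (px py pz : Bool) (x y z : K)
    (hsat : SatisfiesLit K px x ∨ SatisfiesLit K py y ∨ SatisfiesLit K pz z) :
    (gadget₉ K px py pz x y z x y z (gs K px x) x (gs K py y) y (gs K pz z) z).rank = 5 := by
  classical
  set a : K := 1 - gl K px x with ha
  set b : K := 1 - gl K py y with hb
  set c : K := 1 - gl K pz z with hc
  have habc : a * b * c = 0 := by
    rcases hsat with h | h | h
    · rw [ha, sub_gl_eq_zero_of_satisfiesLit px x h, zero_mul, zero_mul]
    · rw [hb, sub_gl_eq_zero_of_satisfiesLit py y h, mul_zero, zero_mul]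
    · rw [hc, sub_gl_eq_zero_of_satisfiesLit pz z h, mul_zero]
  set G := gadget₉ K px py pz x y z x y z (gs K px x) x (gs K py y) y (gs K pz z) z with hG
  refine le_antisymm ?_ ?_
  · -- rank ≤ 5: factorisation through `K⁵`
    have hPQ : G =
        !![1, 0, 0, 0, 0; 1, 0, 0, 0, 0; 0, 1, 0, 0, 0; 0, 1, 0, 0, 0; 0, 0, 1, 0, 0;
            0, 0, 1, 0, 0; 0, 0, 0, 1, 0; 0, 0, 0, 0, 1; 0, 0, 0, -(b * c), c] *
          !![1, x, 0, 0, 0, 0, 0, 0, 0; 0, 0, 1, y, 0, 0, 0, 0, 0; 0, 0, 0, 0, 1, z, 0, 0, 0;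
            0, 0, 0, 0, 0, 0, a, 1, 0; (0 : K), 0, 0, 0, 0, 0, 0, b, 1] := by
      have habc' := habc
      simp only [ha, hb, hc, mul_eq_zero] at habc'
      ext i j
      fin_cases i <;> fin_cases j <;>
        simp [hG, gadget₉, Matrix.mul_apply, Fin.sum_univ_five, ha, hb, hc]
      -- the `(9, 7)` entry `-(b c) a = 0` and the `(9, 8)` entry `-(b c) + c b = 0`
      all_goals first | ring1 | tauto
    rw [hPQ]
    exact (Matrix.rank_mul_le_right _ _).trans ((Matrix.rank_le_card_height _).trans (by simp))
  · -- rank ≥ 5: a unit `5 × 5` minor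
    have hdet : (G.submatrix ![0, 2, 4, 6, 7] ![0, 2, 4, 7, 8]).det = 1 := by
      rw [det_of_leading_rows (k := 2)]
      · rw [Matrix.det_fin_two]
        simp [hG, gadget₉, Matrix.submatrix_apply]
      · intro i j
        fin_cases i <;> fin_cases j <;> simp [hG, gadget₉]
    have := card_le_rank_of_det_submatrix_ne_zero G ![0, 2, 4, 6, 7] ![0, 2, 4, 7, 8]
      (by rw [hdet]; exact one_ne_zero)
    simpa using this

end Lemma21

open Lemma21

/-! ### Lemma 21 -/

variable (K) in
/-- **BIJL 2018, Lemma 21 holds**: (1) a Boolean assignment satisfying the clause admits local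
variables with gadget rank five; (2) gadget rank five forces the clause to be satisfied by a
`{0,1}`-valued variable. Discharge of the named fact `BIJL2018_lemma21`.
[cite: BlaserIkenmeyerJindalLysikov2018, Lemma 21] -/
theorem BIJL2018_lemma21_holds : BIJL2018_lemma21 K := by
  intro px py pz
  refine ⟨fun x y z _ _ _ hsat => ?_, fun x y z u v w u₁ u₂ v₁ v₂ w₁ w₂ h => ?_⟩
  · exact ⟨x, y, z, gs K px x, x, gs K py y, y, gs K pz z, z, rank_gadget₉_eq_five px py pz x y z hsat⟩
  · exact satisfiesLit_of_rank_gadget₉_eq_five px py pz x y z u v w u₁ u₂ v₁ v₂ w₁ w₂ h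

end Literature.Barriers.ValiantsHypothesis

end
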